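import Summits.BirchSwinnertonDyer.BirchSwinnertonDyer.Theorems.KolyvaginRankRigidityAtTwoSwapPairingUpperBoundSplitAtTwo
import Summits.BirchSwinnertonDyer.BirchSwinnertonDyer.Theorems.KolyvaginRankRigidityAtTwoTransverseLagrangianAtTwo
import Summits.BirchSwinnertonDyer.BirchSwinnertonDyer.Theorems.ClassRecordThreeEulerHalvesAtThreeWalkSupplyDisjoint
import Summits.BirchSwinnertonDyer.Rank1Residual.GaloisImage.LocalH1UnramifiedSquare
import HarnessLib

/-!
# Crux V2♭θ `KolyvaginCorankLowerBoundAtTwoTheta` (stmt-BirchSwinnertonDyer-27220), line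
# `kolyvagin_depth_split`, inside of S1, piece **P7b** for the RING-CLASS TRANSVERSE FAMILY — discharged
# (helper, PROVED; seat `bsd-line-krr2-p2` g7)

`pow_smul_localTatePairingZMod_eq_zero_of_localTransverseFamily_two`: the hypothesis `hP7b` of the lead's S1
composition `primeSwapAtTwoLossy_core[_frob]` with constant `c₇' = 0`, for the ring-class transverse family
`𝒯` of the composition (the shape `h𝒯` of the lead's `dualTransported_eq_of_localTransverseFamily_two`), at every
place of a square-free product `c` of Zhang–Kolyvagin primes of index `≥ M + 1` — from three PROVED inputs:
(iso) the lead's Lagrangian theorem at `2` (`dualTransported_eq_of_localTransverseFamily_two`, margin one),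
(disj) `Kum_v ∩ 𝒯_v = 0` (`JET.Walk.disjoint_kummer_iInf_transverseSubgroup`, any `p`), (count)
`#𝒯_v = #E(K_v)[2^M] = #Kum_v` and `#H¹(K_v, E[2^M]) = #E(K_v)[2^M]²`
(`JET.RingClassTransverse.natCard_transverseSubgroup_ringClassField_eq`,
`GaloisImage.natCard_unramifiedSubgroup_torsion_adicCompletion_eq_of_ne_zero`,
`GaloisImage.natCard_galoisCohomology_one_torsion_adicCompletion_eq_sq_of_not_mem`), through this seat's
`pow_smul_localTatePairingZMod_eq_zero_of_disjoint`.  No purity of `𝒯_v` and no Frobenius-class datum is used.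
HONEST FRAMING: helper (`--supports` 27220); S1 / V2♭θ are NOT proved; BSD is not proved by any of this.

References: [cite: Kolyvagin1991MathAnn, §2 (proof of Thm. 2.2)] [cite: McCallumLMS1991, §4, §5 Prop. 5.2]
[cite: Jetchev2008, §4.2 (p. 818)] [cite: MazurRubin2004, Lemma 1.2.4] [cite: MilneADT2006, Ch. I, Lemma 2.9, Thm. 2.8].
-/

set_option autoImplicit false
set_option linter.dupNamespace false

noncomputable section

open scoped Classical
open Function NumberField IsDedekindDomain WeierstrassCurve Field
open Literature.NumberTheory.EllipticCurves Literature.NumberTheory.EllipticCurves.Jetchev2008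
open Literature.NumberTheory.GaloisRepresentations Literature.NumberTheory.GaloisCohomology
open Literature.NumberTheory.GaloisRepresentations.DiscreteGaloisModule (localTatePairingZMod tateDual
  transverseSubgroup SelmerStructure)
open Literature.NumberTheory.Automorphic
open Summit.BirchSwinnertonDyer.Rank1Residual
open Summit.BirchSwinnertonDyer.Rank1Residual.JET.RingClassTransverse
open Summit.BirchSwinnertonDyer.Rank1Residual.JET.SelmerVocabulary
open Summit.BirchSwinnertonDyer.Rank1Residual.JET.GlobalDuality

namespace Summit.BirchSwinnertonDyer.BirchSwinnertonDyer.Theorems.KolyvaginLowerBoundAtTwo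

variable (W : WeierstrassCurve ℚ) [W.IsElliptic] [W.IsGloballyMinimal] (K : Type) [Field K] [NumberField K]

/-- **P7b for the ring-class transverse family at `2`, discharged** (constant `c₇' = 0`): at a place `v` of
the square-free Kolyvagin conductor `c` (indices `≥ M + 1`), for global classes `w`, `C` with `loc_v C ∈ 𝒯_v`,
`2^{a₀} loc_v w ∈ 𝒯_v`, `2^{b₀} loc_v C = 0`: `2^{a₀+b₀−M} · ⟨loc_v w, loc_v (w_* C)⟩_v = 0`.
[cite: Kolyvagin1991MathAnn, §2 (proof of Thm. 2.2)] [cite: McCallumLMS1991, §5 Prop. 5.2] [cite: Jetchev2008, §4.2] -/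
theorem pow_smul_localTatePairingZMod_eq_zero_of_localTransverseFamily_two (hK : IsImaginaryQuadratic K)
    (hD : NumberField.discr K < -4) (ι : K →+* ℂ) [∀ j : ℕ, NumberField (ringClassField K ι j)]
    (M : ℕ) (hM : 1 ≤ M) [NeZero (2 ^ M)]
    [Finite (geomTorsion (W.baseChange K) ((2 ^ M : ℕ) : ℤ))]
    (c : ℕ) (hc : Squarefree c)
    (hkol : ∀ ℓ ∈ c.primeFactors, Zhang2014.IsKolyvaginPrime (W.conductorNorm ℤ) W K 2 ℓ)
    (hkM : ∀ ℓ ∈ c.primeFactors, M + 1 ≤ Zhang2014.kolyvaginIndex W 2 ℓ)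
    (𝒯 : SelmerStructure ((W.baseChange K).torsionGaloisModule ((2 ^ M : ℕ) : ℤ)))
    (h𝒯 : ∀ v : HeightOneSpectrum (𝓞 K), 𝒯 (Sum.inr v) =
      ⨅ ℓ ∈ c.primeFactors.filter (fun ℓ : ℕ ↦ ((ℓ : ℕ) : 𝓞 K) ∈ v.asIdeal),
        ⨅ (w' : HeightOneSpectrum (𝓞 (ringClassField K ι ℓ))) (_ : w'.asIdeal.LiesOver v.asIdeal),
          letI := (adicCompletionOfLiesOver K (ringClassField K ι ℓ) v w').toAlgebra
          transverseSubgroup (GaloisRep.toLocal v ((W.baseChange K).torsionGaloisModule ((2 ^ M : ℕ) : ℤ)))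
            (w'.adicCompletion (ringClassField K ι ℓ)))
    (e : geomTorsion (W.baseChange K) ((2 ^ M : ℕ) : ℤ) → geomTorsion (W.baseChange K) ((2 ^ M : ℕ) : ℤ) →
      AlgebraicClosure K)
    (hμ : ∀ S T, e S T ^ (2 ^ M) = 1)
    (hadd₁ : ∀ S₁ S₂ T, e (S₁ + S₂) T = e S₁ T * e S₂ T)
    (hadd₂ : ∀ S T₁ T₂, e S (T₁ + T₂) = e S T₁ * e S T₂)
    (hgal : ∀ (g : absoluteGaloisGroup K) (S T : geomTorsion (W.baseChange K) ((2 ^ M : ℕ) : ℤ)),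
      g • e S T = e (g • S) (g • T))
    (halt : ∀ T, e T T = 1) (hnondeg : ∀ T, (∀ S, e S T = 1) → T = 0)
    (inv : LocalInvariants K (2 ^ M)) (hperf : inv.IsPerfect)
    (v : HeightOneSpectrum (𝓞 K)) (hvc : v ∈ placesDividing K c)
    (w C : galoisCohomology ((W.baseChange K).torsionGaloisModule ((2 ^ M : ℕ) : ℤ)) 1) {a₀ b₀ : ℕ}
    (hCT : galoisCohomology.localization ((W.baseChange K).torsionGaloisModule ((2 ^ M : ℕ) : ℤ)) (Sum.inr v) 1 C ∈
      𝒯 (Sum.inr v))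
    (hwT : ((2 ^ a₀ : ℕ) : ℤ) •
      galoisCohomology.localization ((W.baseChange K).torsionGaloisModule ((2 ^ M : ℕ) : ℤ)) (Sum.inr v) 1 w ∈
        𝒯 (Sum.inr v))
    (hC0 : ((2 ^ b₀ : ℕ) : ℤ) •
      galoisCohomology.localization ((W.baseChange K).torsionGaloisModule ((2 ^ M : ℕ) : ℤ)) (Sum.inr v) 1 C = 0) :
    (2 ^ (a₀ + b₀ - M) : ℕ) •
        localTatePairingZMod ((W.baseChange K).torsionGaloisModule ((2 ^ M : ℕ) : ℤ)) (2 ^ M) (Sum.inr v)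
          (inv (Sum.inr v))
          (galoisCohomology.localization ((W.baseChange K).torsionGaloisModule ((2 ^ M : ℕ) : ℤ)) (Sum.inr v) 1 w)
          (galoisCohomology.localization
            (((W.baseChange K).torsionGaloisModule ((2 ^ M : ℕ) : ℤ)).tateDual (2 ^ M)) (Sum.inr v) 1
            (galoisCohomology.map
              (weilDualIntertwining (W.baseChange K) (2 ^ M) e hμ hadd₁ hadd₂ hgal) 1 C)) = 0 := by
  classical
  haveI : Fact (Nat.Prime 2) := ⟨Nat.prime_two⟩
  haveI : CharZero (v.adicCompletion K) := charZero_adicCompletion v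
  have hc0 : c ≠ 0 := hc.ne_zero
  -- the prime `ℓ₀ ∣ c` under `v`, unique
  obtain ⟨ℓ₀, hℓ₀c, hℓ₀v⟩ := (natCast_mem_iff_exists_primeFactor_mem hc0 v).mp
    ((mem_placesDividing_iff_natCast_mem hc0 v).mp hvc)
  have hℓ₀ := hkol ℓ₀ hℓ₀c
  have hℓ₀p : ℓ₀.Prime := hℓ₀.1
  have hℓ₀0 : ℓ₀ ≠ 0 := hℓ₀p.ne_zero
  have hMℓ₀ : M ≤ Zhang2014.kolyvaginIndex W 2 ℓ₀ := Nat.le_of_succ_le (hkM ℓ₀ hℓ₀c)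
  have huniq : ∀ ℓ ∈ c.primeFactors, ((ℓ : ℕ) : 𝓞 K) ∈ v.asIdeal → ℓ = ℓ₀ := by
    intro ℓ hℓc hℓv
    by_contra hne
    have hcop : Nat.Coprime ℓ₀ ℓ :=
      (Nat.coprime_primes hℓ₀p (Nat.prime_of_mem_primeFactors hℓc)).mpr (Ne.symm hne)
    exact X11b.Three.Koly.Method2.not_mem_asIdeal_of_coprime K hcop v hℓ₀v hℓv
  -- a place `w₀ ∣ v` of `K[ℓ₀]`; `𝒯_v` is the transverse subgroup there
  haveI := (finiteDimensional_and_isGalois_ringClassField hK ι hℓ₀0).2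
  obtain ⟨w₀⟩ := (inferInstance : Nonempty (SemiLocal.Place K (ringClassField K ι ℓ₀) v))
  haveI hw₀ : (w₀ : HeightOneSpectrum (𝓞 (ringClassField K ι ℓ₀))).asIdeal.LiesOver v.asIdeal :=
    SemiLocal.Place.liesOver w₀
  letI := (adicCompletionOfLiesOver K (ringClassField K ι ℓ₀) v
    (w₀ : HeightOneSpectrum (𝓞 (ringClassField K ι ℓ₀)))).toAlgebra
  have h𝒯v : 𝒯 (Sum.inr v) =
      transverseSubgroup (GaloisRep.toLocal v ((W.baseChange K).torsionGaloisModule ((2 ^ M : ℕ) : ℤ)))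
        ((w₀ : HeightOneSpectrum (𝓞 (ringClassField K ι ℓ₀))).adicCompletion (ringClassField K ι ℓ₀)) := by
    rw [h𝒯 v]
    ext y
    simp only [AddSubgroup.mem_iInf, Finset.mem_filter, and_imp]
    constructor
    · intro H
      exact H ℓ₀ hℓ₀c hℓ₀v (w₀ : HeightOneSpectrum (𝓞 (ringClassField K ι ℓ₀))) hw₀
    · intro hy ℓ hℓc hℓv w' hw'
      obtain rfl := huniq ℓ hℓc hℓv
      rw [transverseSubgroup_adicCompletion_eq_of_liesOver
        ((W.baseChange K).torsionGaloisModule ((2 ^ M : ℕ) : ℤ)) (ringClassField K ι ℓ) v w'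
        (w₀ : HeightOneSpectrum (𝓞 (ringClassField K ι ℓ)))]
      exact hy
  -- (iso)
  have h𝒯sd := dualTransported_eq_of_localTransverseFamily_two W K hK hD ι M hM c hc hkol hkM 𝒯 h𝒯 e hμ hadd₁
    hadd₂ hgal halt hnondeg inv hperf v hvc
  -- (disj)
  have hdisj : Disjoint ((W.baseChange K).kummerSelmerStructure ((2 ^ M : ℕ) : ℤ) (Sum.inr v : Place K))
      (𝒯 (Sum.inr v)) := by
    have h := JET.Walk.disjoint_kummer_iInf_transverseSubgroup W K hK hD ι M hℓ₀ v hℓ₀v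
    refine h.mono_right ?_
    rw [h𝒯 v]
    exact iInf₂_le ℓ₀ (Finset.mem_filter.mpr ⟨hℓ₀c, hℓ₀v⟩)
  -- (count): `#𝒯_v = #E(K_v)[2^M] = #Kum_v`, `#H¹ = #E(K_v)[2^M]²`
  have hpv : ((2 : ℕ) : 𝓞 K) ∉ v.asIdeal := by
    have h := (hasGoodReductionAt_of_zhangKolyvagin W K Nat.prime_two hℓ₀ v hℓ₀v 1).2
    rwa [pow_one, Int.cast_natCast] at h
  have hgood := (hasGoodReductionAt_of_zhangKolyvagin W K Nat.prime_two hℓ₀ v hℓ₀v 1).1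
  have hTc : Nat.card (𝒯 (Sum.inr v)) = Nat.card (nsmulAddMonoidHom (2 ^ M) :
      ((W.baseChange K).baseChange (v.adicCompletion K)).toAffine.Point →+ _).ker := by
    rw [h𝒯v]
    exact natCard_transverseSubgroup_ringClassField_eq W K hK hD ι M hℓ₀ hMℓ₀ v hℓ₀v
      (w₀ : HeightOneSpectrum (𝓞 (ringClassField K ι ℓ₀)))
  have hKc : Nat.card ((W.baseChange K).kummerSelmerStructure ((2 ^ M : ℕ) : ℤ) (Sum.inr v : Place K)) =
      Nat.card (nsmulAddMonoidHom (2 ^ M) :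
        ((W.baseChange K).baseChange (v.adicCompletion K)).toAffine.Point →+ _).ker := by
    rw [X11b.KummerPT.kummerSelmerStructure_inr_eq_unramifiedSubgroup (W.baseChange K) 2 M hpv hgood]
    exact GaloisImage.LocalH1UnramifiedSquare.natCard_unramifiedSubgroup_torsion_adicCompletion_eq_of_ne_zero
      (W.baseChange K) v
      (NeZero.ne (2 ^ M))
  have hH1 : Nat.card (galoisCohomology ((((W.baseChange K).torsionGaloisModule ((2 ^ M : ℕ) : ℤ))).toLocal
        (Sum.inr v : Place K)) 1) =
      Nat.card (nsmulAddMonoidHom (2 ^ M) :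
        ((W.baseChange K).baseChange (v.adicCompletion K)).toAffine.Point →+ _).ker ^ 2 := by
    have h := GaloisImage.natCard_galoisCohomology_one_torsion_adicCompletion_eq_sq_of_not_mem (W.baseChange K) v
      2 hpv (M - 1)
    rw [Nat.sub_add_cancel hM] at h
    exact h
  have hcard : Nat.card (galoisCohomology ((((W.baseChange K).torsionGaloisModule ((2 ^ M : ℕ) : ℤ))).toLocal
        (Sum.inr v : Place K)) 1) ≤
      Nat.card ((W.baseChange K).kummerSelmerStructure ((2 ^ M : ℕ) : ℤ) (Sum.inr v : Place K)) *
        Nat.card (𝒯 (Sum.inr v)) := by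
    rw [hH1, hKc, hTc, sq]
  exact pow_smul_localTatePairingZMod_eq_zero_of_disjoint W M e hμ hadd₁ hadd₂ hgal inv 𝒯 hK hℓ₀ hMℓ₀ v hℓ₀v
    h𝒯sd hdisj hcard w C hCT hwT hC0

end Summit.BirchSwinnertonDyer.BirchSwinnertonDyer.Theorems.KolyvaginLowerBoundAtTwo

end
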